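import Literature.Analysis.FluidPDE.TaoCascadeMotion
import Literature.Analysis.FluidPDE.TaoAveragedComplexAverage
import Literature.Analysis.FluidPDE.TaoAveragedSlotFourier
import HarnessLib

/-!
# Tao's averaged Navier–Stokes blow-up: the wavelets `ψ_{i,n}` on the Fourier side

T. Tao, *Finite time blowup for an averaged three-dimensional Navier–Stokes equation*,
J. Amer. Math. Soc. **29** (2016), 601–674 = arXiv:1402.0290v3 (held as `paper:arxiv-1402.0290`),
§4, pp. 21–22: the first facts about the wavelets `ψ_{i,n}(x) = (1+ε₀)^{3n/2} ψ_i((1+ε₀)ⁿx)` of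
the data of p. 21 (accepted `CascadeWaveletData`, constructed in `TaoCascadeWaveletData.lean`) that
the proof of Lemma 4.1 (equations of motion) uses on p. 22: "Taking Fourier transforms … As
these dilated balls are disjoint …", "Taking inner products of (4.14) with `ψ_{i,n}`", and the
initial conditions (4.8)–(4.9) (`X_{i,n}(0) = ⟨ψ_{1,n₀}, ψ_{i,n}⟩ = 1_{(i,n)=(1,n₀)}`).
Everything here is **proved**:

* `pairing_eq_inner`, `pairing_self`, `pairing_eq_integral_fourierFn` — against a real field the
  complex-bilinear pairing `⟨u, w⟩ = ∫ u · w` of `TaoAveragedSobolev.lean` is the `L²` inner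
  product, `⟨u, u⟩ = ‖u‖²`, and Parseval holds (Mathlib's `Lp.inner_fourier_eq`);
* `fourierFn_cascadeWavelet` — `ψ̂_{i,n}(ξ) = c^{3/2} c^{-3} ψ̂_i(ξ/c)`, `c = (1+ε₀)ⁿ`, a.e.;
  `CascadeWaveletData.fourierFn_cascadeWavelet_eq_zero` — `ψ̂_{i,n}` vanishes a.e. off
  `(1+ε₀)ⁿ · (B_i ∪ -B_i)` = the accepted `freqRegion 𝒟 i n` of `TaoCascadeMotion.lean`;
  `norm_of_mem_freqRegion` — that region lies in the annulus `(1+ε₀)ⁿ < |ξ| ≤ (1+ε₀)ⁿ(1+ε₀/2)`;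
  `not_mem_freqRegion_of_ne`, `disjoint_freqRegion` — distinct modes `(i,n) ≠ (j,k)` have
  disjoint regions;
* `CascadeWaveletData.norm_cascadeWavelet` (`‖ψ_{i,n}‖ = 1`, from the tree's `norm_dil`,
  `TaoAveragedSlotFourier.lean`) and the **orthonormality**
  `CascadeWaveletData.pairing_cascadeWavelet`: `⟨ψ_{i,n}, ψ_{j,k}⟩ = 1_{(i,n)=(j,k)}`;
* `cdot_fourier_eq_zero_of_isDivFree` — a divergence-free real Schwartz field has `ξ · ψ̂(ξ) = 0`
  (Tao p. 3), via Mathlib's `SchwartzMap.fourier_lineDerivOp_eq`;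
* `CascadeWaveletData.memH10df_cascadeWavelet` — **`ψ_{i,n} ∈ H¹⁰_df(ℝ³)`** (finite `H¹⁰` norm:
  `ψ̂_{i,n}` is bounded and compactly supported; real; divergence free on the Fourier side), so
  the wavelets are admissible test fields in the mild formulation (3.3) and the datum (4.4) lies
  in `H¹⁰_df`;
* `CascadeWaveletData.enorm_pairing_cascadeWavelet_le` — the coefficient decay
  `|⟨u, ψ_{i,n}⟩| ≤ (1 + (1+ε₀)^{2n})^{-5} ‖u‖_{H¹⁰}` behind the a priori bound (4.6) (Cauchy–Schwarz
  on the Fourier side, `ψ̂_{i,n}` living where `|ξ| > (1+ε₀)ⁿ` with unit `L²` mass).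

## Mathlib / tree search

Parseval on `L²` is Mathlib's `MeasureTheory.Lp.inner_fourier_eq`; the Schwartz/`L²` comparison
is `SchwartzMap.toLp_fourier_eq`; Hölder for `lintegral` is `ENNReal.lintegral_mul_le_Lp_mul_Lq`.
The tree has realness of the wavelets (`isReal_cascadeWavelet`, `TaoAveragedComplexAverage.lean`),
the dilation formulas (`schwartzL2_schwartzDil`, `fourier_complexify_schwartzDil`,
`TaoCascadeOperator.lean`), `norm_dil` / `fourierFn_dil` (`TaoAveragedSlotFourier.lean`, used here),
the region `freqRegion` and projection `modeProjection` (`TaoCascadeMotion.lean`, used here), and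
since 2026-08-15 an `L²` toolkit `TaoMultiplierToolkit.lean` with `pairing_swap` (symmetry of the
pairing), `IsReal.pairing_eq_inner` (real *first* slot; `pairing_eq_inner` below is the real
*second* slot version, which is what pairing against the real wavelets needs) and
`inner_eq_integral_fourierFn`; `cdot_smul_left` lives in `TaoAveragedSlotSobolev.lean` (not
imported, to keep this file light). No orthonormality / `H¹⁰_df` membership / coefficient decay of
the wavelets existed (`lean search pairing_cascadeWavelet memH10df_cascadeWavelet`: nothing).

## References

* T. Tao, J. Amer. Math. Soc. 29 (2016), 601–674, arXiv:1402.0290v3, §4 pp. 21–22, (1.11),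
  Def. 3.1. Key `Tao2016AveragedNS`.
-/

noncomputable section

open MeasureTheory Set Filter FourierTransform Metric
open scoped ENNReal NNReal SchwartzMap Topology RealInnerProductSpace Pointwise

namespace Literature.Analysis.FluidPDE.Tao2016


section WaveletFourier

open scoped ComplexInnerProductSpace

/-! ### The bilinear pairing on real fields is the `L²` inner product; Parseval -/

/-- On a **real** field `w`, the bilinear pairing `⟨u, w⟩ = ∫ u · w` is the `L²` inner product
`⟪w, u⟫` (no conjugate is lost). [folklore] -/
theorem pairing_eq_inner {u w : L2C} (hw : IsReal w) : pairing u w = inner ℂ w u := by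
  rw [pairing, MeasureTheory.L2.inner_def]
  refine integral_congr_ae ?_
  filter_upwards [hw] with x hx
  simp only [cdot, PiLp.inner_apply, RCLike.inner_apply]
  refine Finset.sum_congr rfl fun i _ => ?_
  rw [(Complex.conj_eq_iff_im).2 (hx i), mul_comm]

/-- On a real field, `⟨u, u⟩ = ‖u‖²_{L²}`. [folklore] -/
theorem pairing_self {u : L2C} (hu : IsReal u) : pairing u u = ((‖u‖ ^ 2 : ℝ) : ℂ) := by
  rw [pairing_eq_inner hu, inner_self_eq_norm_sq_to_K]
  norm_cast

/-- **Parseval for the pairing with a real field**: `⟨u, w⟩ = ∫ ⟪ŵ(ξ), û(ξ)⟫ dξ`. [folklore] -/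
theorem pairing_eq_integral_fourierFn {u w : L2C} (hw : IsReal w) :
    pairing u w = ∫ ξ, inner ℂ (fourierFn w ξ) (fourierFn u ξ) := by
  rw [pairing_eq_inner hw, ← MeasureTheory.Lp.inner_fourier_eq, MeasureTheory.L2.inner_def]
  rfl

/-! ### Fourier transform of the wavelets -/

/-- The Fourier transform of the `L²` class of a real Schwartz field is (a.e.) the Fourier
transform of the field. [folklore] -/
theorem fourierFn_schwartzL2 (ψ : 𝓢((EuclideanSpace ℝ (Fin 3)), (EuclideanSpace ℝ (Fin 3)))) :
    fourierFn (schwartzL2 ψ) =ᵐ[volume] 𝓕 (FunctionSpaces.EuclideanSpace.complexify ∘ ⇑ψ) := by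
  unfold fourierFn
  rw [schwartzL2_eq_toLp, SchwartzMap.toLp_fourier_eq]
  exact SchwartzMap.coeFn_toLp _ _ _

/-- A wavelet is the `L²` class of a dilated profile: `ψ_n = Dil_{(1+ε₀)ⁿ} ψ`. [cite: Tao2016AveragedNS, Def. 3.1] -/
theorem cascadeWavelet_eq_schwartzL2 {ε₀ : ℝ} (hε : 0 < 1 + ε₀) (ψ : 𝓢((EuclideanSpace ℝ (Fin 3)), (EuclideanSpace ℝ (Fin 3)))) (n : ℤ) :
    cascadeWavelet ε₀ ψ n =
      schwartzL2 (schwartzDil (Units.mk0 ((1 + ε₀) ^ n) (zpow_ne_zero n hε.ne')) ψ) := by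
  rw [schwartzL2_schwartzDil, Units.val_mk0]
  rfl

/-- **The Fourier transform of a wavelet**: with `c = (1+ε₀)ⁿ`,
`ψ̂_n(ξ) = c^{3/2} c^{-3} ψ̂(ξ/c)` for a.e. `ξ`. [cite: Tao2016AveragedNS, Def. 3.1] -/
theorem fourierFn_cascadeWavelet {ε₀ : ℝ} (hε : 0 < 1 + ε₀) (ψ : 𝓢((EuclideanSpace ℝ (Fin 3)), (EuclideanSpace ℝ (Fin 3)))) (n : ℤ) :
    fourierFn (cascadeWavelet ε₀ ψ n) =ᵐ[volume] fun ξ =>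
      ((((1 + ε₀) ^ n) ^ ((3 : ℝ) / 2) : ℝ) : ℂ) • (|(((1 + ε₀) ^ n) ^ 3)⁻¹| •
        𝓕 (FunctionSpaces.EuclideanSpace.complexify ∘ ⇑ψ) (((1 + ε₀) ^ n)⁻¹ • ξ)) := by
  rw [cascadeWavelet_eq_schwartzL2 hε]
  filter_upwards [fourierFn_schwartzL2
    (schwartzDil (Units.mk0 ((1 + ε₀) ^ n) (zpow_ne_zero n hε.ne')) ψ)] with ξ hξ
  rw [hξ, fourier_complexify_schwartzDil, Units.val_mk0]

namespace CascadeWaveletData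

variable {ε₀ : ℝ} {m : ℕ} (𝒟 : CascadeWaveletData ε₀ m)

/-- Membership in the frequency region `(1+ε₀)ⁿ·(Bᵢ ∪ -Bᵢ)` of the mode `(i,n)` (accepted
`freqRegion`), unfolded: `(1+ε₀)⁻ⁿ ξ ∈ Bᵢ` or `-(1+ε₀)⁻ⁿ ξ ∈ Bᵢ`. [cite: Tao2016AveragedNS, Lemma 4.1] -/
theorem mem_freqRegion_iff (i : Fin m) (n : ℤ) (ξ : EuclideanSpace ℝ (Fin 3)) :
    ξ ∈ freqRegion 𝒟 i n ↔
      ((1 + ε₀) ^ n)⁻¹ • ξ ∈ ball (𝒟.center i) (𝒟.radius i) ∨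
        -(((1 + ε₀) ^ n)⁻¹ • ξ) ∈ ball (𝒟.center i) (𝒟.radius i) :=
  Iff.rfl

/-- Off `Bᵢ ∪ -Bᵢ` the Fourier transform of `ψᵢ` vanishes. [cite: Tao2016AveragedNS, §4 p. 21] -/
theorem fourier_eq_zero_of_not_mem (i : Fin m) {η : EuclideanSpace ℝ (Fin 3)}
    (h : ¬ (η ∈ ball (𝒟.center i) (𝒟.radius i) ∨ -η ∈ ball (𝒟.center i) (𝒟.radius i))) :
    𝓕 (FunctionSpaces.EuclideanSpace.complexify ∘ ⇑(𝒟.ψ i)) η = 0 := by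
  simp only [not_or] at h
  exact 𝒟.fourier_support i η h.1 h.2

/-- Points of `Bᵢ ∪ -Bᵢ` have norm in `(1, 1 + ε₀/2]`. [cite: Tao2016AveragedNS, §4 p. 21] -/
theorem norm_of_mem_ball_or (i : Fin m) {η : EuclideanSpace ℝ (Fin 3)}
    (h : η ∈ ball (𝒟.center i) (𝒟.radius i) ∨ -η ∈ ball (𝒟.center i) (𝒟.radius i)) :
    1 < ‖η‖ ∧ ‖η‖ ≤ 1 + ε₀ / 2 := by
  rcases h with h | h
  · exact 𝒟.ball_subset i h
  · simpa [norm_neg] using 𝒟.ball_subset i h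

/-- **Frequency localisation of the wavelets**: for a.e. `ξ`, `ψ̂_{i,n}(ξ) = 0` unless
`ξ ∈ (1+ε₀)ⁿ·(Bᵢ ∪ -Bᵢ)` (`freqRegion`). [cite: Tao2016AveragedNS, §4 Lemma 4.1] -/
theorem fourierFn_cascadeWavelet_eq_zero (hε : 0 < 1 + ε₀) (i : Fin m) (n : ℤ) :
    ∀ᵐ ξ ∂(volume : Measure (EuclideanSpace ℝ (Fin 3))), ξ ∉ freqRegion 𝒟 i n →
      fourierFn (cascadeWavelet ε₀ (𝒟.ψ i) n) ξ = 0 := by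
  filter_upwards [fourierFn_cascadeWavelet hε (𝒟.ψ i) n] with ξ hξ hnot
  rw [hξ, 𝒟.fourier_eq_zero_of_not_mem i ((𝒟.mem_freqRegion_iff i n ξ).not.1 hnot), smul_zero, smul_zero]

/-- If `ξ ∈ (1+ε₀)ⁿ·(Bᵢ ∪ -Bᵢ)` then `(1+ε₀)ⁿ < |ξ| ≤ (1+ε₀)ⁿ (1 + ε₀/2)`. [cite: Tao2016AveragedNS, §4 Lemma 4.1] -/
theorem norm_of_mem_freqRegion (hε : 0 < 1 + ε₀) (i : Fin m) (n : ℤ) {ξ : EuclideanSpace ℝ (Fin 3)}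
    (h : ξ ∈ freqRegion 𝒟 i n) :
    (1 + ε₀) ^ n < ‖ξ‖ ∧ ‖ξ‖ ≤ (1 + ε₀) ^ n * (1 + ε₀ / 2) := by
  have hc : 0 < (1 + ε₀) ^ n := zpow_pos hε n
  have h' := 𝒟.norm_of_mem_ball_or i ((𝒟.mem_freqRegion_iff i n ξ).1 h)
  rw [norm_smul, norm_inv, Real.norm_of_nonneg hc.le, lt_inv_mul_iff₀ hc, inv_mul_le_iff₀ hc] at h'
  simpa using h'

/-- **Distinct modes have disjoint frequency regions**: if `(i, n) ≠ (j, k)` then no `ξ` lies in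
both `(1+ε₀)ⁿ·(Bᵢ ∪ -Bᵢ)` and `(1+ε₀)ᵏ·(Bⱼ ∪ -Bⱼ)` (different scales: the annuli
`(1+ε₀)ⁿ (1, 1+ε₀/2]` are disjoint since `1 + ε₀/2 < 1 + ε₀`; same scale: the `2m` balls are
disjoint). [cite: Tao2016AveragedNS, §4 Lemma 4.1] -/
theorem not_mem_freqRegion_of_ne (hε : 0 < ε₀) {i j : Fin m} {n k : ℤ} (hne : (i, n) ≠ (j, k))
    {ξ : EuclideanSpace ℝ (Fin 3)} (hi : ξ ∈ freqRegion 𝒟 i n) : ξ ∉ freqRegion 𝒟 j k := by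
  intro hj
  have hε' : 0 < 1 + ε₀ := by linarith
  by_cases hnk : n = k
  · subst hnk
    have hij : i ≠ j := fun h => hne (by rw [h])
    rw [mem_freqRegion_iff] at hi hj
    set η := ((1 + ε₀) ^ n)⁻¹ • ξ
    have hneg : ∀ {a : Fin m}, -η ∈ ball (𝒟.center a) (𝒟.radius a) ↔
        η ∈ -ball (𝒟.center a) (𝒟.radius a) := fun {a} => by rw [Set.mem_neg]
    rcases hi with hi | hi <;> rcases hj with hj | hj
    · exact Set.disjoint_left.1 (𝒟.disjoint i j hij) hi hj
    · exact Set.disjoint_left.1 (𝒟.disjoint_neg i j) hi (hneg.1 hj)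
    · exact Set.disjoint_left.1 (𝒟.disjoint_neg j i) hj (hneg.1 hi)
    · have hi' : -η ∈ ball (𝒟.center i) (𝒟.radius i) := hi
      have hj' : -η ∈ ball (𝒟.center j) (𝒟.radius j) := hj
      exact Set.disjoint_left.1 (𝒟.disjoint i j hij) hi' hj'
  · obtain ⟨h1, h2⟩ := 𝒟.norm_of_mem_freqRegion hε' i n hi
    obtain ⟨h3, h4⟩ := 𝒟.norm_of_mem_freqRegion hε' j k hj
    have key : ∀ {a b : ℤ}, a < b → (1 + ε₀) ^ a * (1 + ε₀ / 2) < (1 + ε₀) ^ b := by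
      intro a b hab
      calc (1 + ε₀) ^ a * (1 + ε₀ / 2) < (1 + ε₀) ^ a * (1 + ε₀) :=
            mul_lt_mul_of_pos_left (by linarith) (zpow_pos hε' a)
        _ = (1 + ε₀) ^ (a + 1) := (zpow_add_one₀ hε'.ne' a).symm
        _ ≤ (1 + ε₀) ^ b := zpow_le_zpow_right₀ (by linarith) (by omega)
    rcases lt_or_gt_of_ne hnk with hlt | hlt
    · linarith [key hlt]
    · linarith [key hlt]

/-- The regions of distinct modes are disjoint (set form). [cite: Tao2016AveragedNS, §4 Lemma 4.1] -/
theorem disjoint_freqRegion (hε : 0 < ε₀) {i j : Fin m} {n k : ℤ} (hne : (i, n) ≠ (j, k)) :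
    Disjoint (freqRegion 𝒟 i n) (freqRegion 𝒟 j k) :=
  Set.disjoint_left.2 fun _ hξ => 𝒟.not_mem_freqRegion_of_ne hε hne hξ

/-! ### Orthonormality of the wavelets -/

/-- **The wavelets have unit norm**: `‖ψ_{i,n}‖_{L²} = 1` (`‖ψ_i‖ = 1` and `Dil` is an
isometry). [cite: Tao2016AveragedNS, §4 p. 21] -/
theorem norm_cascadeWavelet (hε : 0 < 1 + ε₀) (i : Fin m) (n : ℤ) :
    ‖cascadeWavelet ε₀ (𝒟.ψ i) n‖ = 1 := by
  rw [cascadeWavelet, norm_dil _ (zpow_pos hε n), 𝒟.norm_eq_one]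

/-- **Orthogonality of distinct modes**: `⟨ψ_{i,n}, ψ_{j,k}⟩ = 0` for `(i,n) ≠ (j,k)` (disjoint
Fourier supports, Parseval). [cite: Tao2016AveragedNS, §4 Lemma 4.1] -/
theorem pairing_cascadeWavelet_of_ne (hε : 0 < ε₀) {i j : Fin m} {n k : ℤ}
    (hne : (i, n) ≠ (j, k)) :
    pairing (cascadeWavelet ε₀ (𝒟.ψ i) n) (cascadeWavelet ε₀ (𝒟.ψ j) k) = 0 := by
  have hε' : 0 < 1 + ε₀ := by linarith
  rw [pairing_eq_integral_fourierFn (isReal_cascadeWavelet ε₀ (𝒟.ψ j) k)]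
  refine (integral_congr_ae ?_).trans (integral_zero _ _)
  filter_upwards [𝒟.fourierFn_cascadeWavelet_eq_zero hε' i n,
    𝒟.fourierFn_cascadeWavelet_eq_zero hε' j k] with ξ hi hj
  by_cases h : ξ ∈ freqRegion 𝒟 i n
  · rw [hj (𝒟.not_mem_freqRegion_of_ne hε hne h), inner_zero_left]
  · rw [hi h, inner_zero_right]

/-- **Normalisation**: `⟨ψ_{i,n}, ψ_{i,n}⟩ = 1`. [cite: Tao2016AveragedNS, §4 p. 21] -/
theorem pairing_cascadeWavelet_self (hε : 0 < 1 + ε₀) (i : Fin m) (n : ℤ) :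
    pairing (cascadeWavelet ε₀ (𝒟.ψ i) n) (cascadeWavelet ε₀ (𝒟.ψ i) n) = 1 := by
  rw [pairing_self (isReal_cascadeWavelet ε₀ (𝒟.ψ i) n), 𝒟.norm_cascadeWavelet hε]
  simp

/-- The orthonormality relations `⟨ψ_{i,n}, ψ_{j,k}⟩ = 1_{(i,n)=(j,k)}`, which give the initial
condition (4.9) `X_{i,n}(0) = 1_{(i,n)=(1,n₀)}` for the datum `ψ_{1,n₀}`. [cite: Tao2016AveragedNS, §4 (4.9)] -/
theorem pairing_cascadeWavelet (hε : 0 < ε₀) (i j : Fin m) (n k : ℤ) :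
    pairing (cascadeWavelet ε₀ (𝒟.ψ i) n) (cascadeWavelet ε₀ (𝒟.ψ j) k) =
      if i = j ∧ n = k then 1 else 0 := by
  split_ifs with h
  · obtain ⟨rfl, rfl⟩ := h
    exact 𝒟.pairing_cascadeWavelet_self (by linarith) i n
  · exact 𝒟.pairing_cascadeWavelet_of_ne hε fun h' => h (Prod.mk.inj h')

end CascadeWaveletData

/-! ### The wavelets lie in `H¹⁰_df` -/

/-- **A divergence-free real Schwartz field is divergence free on the Fourier side**:
`ξ · ψ̂(ξ) = 0` for every `ξ` (from `𝓕(∂ⱼψ) = 2πi ξⱼ ψ̂`, summed over `j`; Tao, p. 3: "the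
divergence-free condition ensures that `û(ξ) ∈ ξ^⊥`"). [folklore] -/
theorem cdot_fourier_eq_zero_of_isDivFree {ψ : 𝓢((EuclideanSpace ℝ (Fin 3)), (EuclideanSpace ℝ (Fin 3)))} (hψ : VectorCalculus.IsDivFree ⇑ψ)
    (ξ : (EuclideanSpace ℝ (Fin 3))) :
    cdot (FunctionSpaces.EuclideanSpace.complexify ξ)
      (𝓕 (FunctionSpaces.EuclideanSpace.complexify ∘ ⇑ψ) ξ) = 0 := by
  open LineDeriv in
  set sC := schwartzC ψ with hsC
  -- the complexified divergence, a Schwartz scalar, vanishes identically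
  have hdiv : ∀ v : (EuclideanSpace ℝ (Fin 3)), ∑ k : Fin 3, (∂_{EuclideanSpace.single k (1 : ℝ)} sC) v k = 0 := by
    intro v
    have hfd : fderiv ℝ (⇑sC) v = complexifyL.comp (fderiv ℝ ⇑ψ v) :=
      (complexifyL.hasFDerivAt.comp v (ψ.hasFDerivAt v)).fderiv
    simp only [SchwartzMap.lineDerivOp_apply_eq_fderiv, hfd, ContinuousLinearMap.coe_comp,
      Function.comp_apply, LinearIsometry.coe_toContinuousLinearMap,
      FunctionSpaces.EuclideanSpace.complexify_apply]
    rw [← Complex.ofReal_sum, Complex.ofReal_eq_zero]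
    have h := hψ v
    rw [divergence_eq_sum_inner_fderiv (EuclideanSpace.basisFun (Fin 3) ℝ)] at h
    simpa [EuclideanSpace.basisFun_apply, EuclideanSpace.inner_single_left] using h
  -- its Fourier transform is `2πi ξ · ψ̂(ξ)`
  have hg : ∀ k : Fin 3,
      (fun x : (EuclideanSpace ℝ (Fin 3)) => inner ℝ x (EuclideanSpace.single k (1 : ℝ))).HasTemperateGrowth :=
    fun k => ((innerSL ℝ).flip (EuclideanSpace.single k (1 : ℝ))).hasTemperateGrowth
  have hF : ∑ k : Fin 3, (𝓕 (∂_{EuclideanSpace.single k (1 : ℝ)} sC) : 𝓢((EuclideanSpace ℝ (Fin 3)), (EuclideanSpace ℂ (Fin 3)))) ξ k =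
      (2 * Real.pi * Complex.I) * cdot (FunctionSpaces.EuclideanSpace.complexify ξ)
        (𝓕 (FunctionSpaces.EuclideanSpace.complexify ∘ ⇑ψ) ξ) := by
    simp only [SchwartzMap.fourier_lineDerivOp_eq, smul_apply,
      SchwartzMap.smulLeftCLM_apply_apply (hg _)]
    simp only [EuclideanSpace.inner_single_right, one_mul, conj_trivial, PiLp.smul_apply,
      smul_eq_mul, cdot, Finset.mul_sum, FunctionSpaces.EuclideanSpace.complexify_apply, hsC,
      SchwartzMap.fourier_coe, coe_schwartzC, Complex.real_smul]
  -- and also the Fourier transform of zero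
  have hF0 : ∑ k : Fin 3, (𝓕 (∂_{EuclideanSpace.single k (1 : ℝ)} sC) : 𝓢((EuclideanSpace ℝ (Fin 3)), (EuclideanSpace ℂ (Fin 3)))) ξ k = 0 := by
    set D : Fin 3 → 𝓢((EuclideanSpace ℝ (Fin 3)), (EuclideanSpace ℂ (Fin 3))) := fun k => ∂_{EuclideanSpace.single k (1 : ℝ)} sC with hD
    have h1 : ∀ k : Fin 3, (𝓕 (D k) : 𝓢((EuclideanSpace ℝ (Fin 3)), (EuclideanSpace ℂ (Fin 3)))) ξ k = 𝓕 (fun v => D k v k) ξ := fun k => by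
      rw [SchwartzMap.fourier_coe]
      exact fourier_apply_coord (D k).integrable ξ k
    have h2 := fourier_finset_sum Finset.univ (F := fun k v => D k v k)
      (fun k _ => (EuclideanSpace.proj k : (EuclideanSpace ℂ (Fin 3)) →L[ℂ] ℂ).integrable_comp (D k).integrable) ξ
    have h3 : (fun v => ∑ k ∈ Finset.univ, (fun k v => D k v k) k v) = fun _ => (0 : ℂ) := by
      funext v
      exact hdiv v
    rw [h3] at h2
    simp only [Real.fourier_eq, smul_zero, integral_zero] at h2
    rw [Finset.sum_congr rfl fun k _ => h1 k]
    exact h2.symm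
  have h2π : (2 * Real.pi * Complex.I) ≠ 0 := by simp [Real.pi_ne_zero]
  exact (mul_eq_zero.1 (hF.symm.trans hF0)).resolve_left h2π

namespace CascadeWaveletData

variable {ε₀ : ℝ} {m : ℕ} (𝒟 : CascadeWaveletData ε₀ m)

/-- **The wavelets are divergence free on the Fourier side**: `ξ · ψ̂_{i,n}(ξ) = 0` a.e. [cite: Tao2016AveragedNS, §4 p. 21] -/
theorem isFourierDivFree_cascadeWavelet (hε : 0 < 1 + ε₀) (i : Fin m) (n : ℤ) :
    IsFourierDivFree (cascadeWavelet ε₀ (𝒟.ψ i) n) := by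
  unfold IsFourierDivFree
  filter_upwards [fourierFn_cascadeWavelet hε (𝒟.ψ i) n] with ξ hξ
  set c : ℝ := (1 + ε₀) ^ n with hc
  have hc0 : c ≠ 0 := zpow_ne_zero n hε.ne'
  have hξc : FunctionSpaces.EuclideanSpace.complexify ξ =
      (c : ℂ) • FunctionSpaces.EuclideanSpace.complexify (c⁻¹ • ξ) := by
    conv_lhs => rw [← smul_inv_smul₀ hc0 ξ]
    rw [LinearIsometry.map_smul, Complex.coe_smul]
  have hleft : ∀ (z : ℂ) (a b : EuclideanSpace ℂ (Fin 3)), cdot (z • a) b = z * cdot a b :=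
    fun z a b => by simp [cdot, Finset.mul_sum, mul_assoc]
  rw [hξ, ← Complex.coe_smul, cdot_smul_right, cdot_smul_right, hξc, hleft,
    cdot_fourier_eq_zero_of_isDivFree (𝒟.isDivFree i)]
  simp

/-- **The wavelets have finite `H¹⁰` norm** (indeed every Sobolev norm: `ψ̂_{i,n}` is bounded and
supported in the ball `|ξ| ≤ (1+ε₀)ⁿ(1+ε₀/2)`). [cite: Tao2016AveragedNS, §4 p. 21] -/
theorem eFourierSobolevNorm_cascadeWavelet_lt_top (hε : 0 < 1 + ε₀) (s : ℝ) (hs : 0 ≤ s)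
    (i : Fin m) (n : ℤ) :
    FunctionSpaces.eFourierSobolevNorm s (cascadeWavelet ε₀ (𝒟.ψ i) n) < ∞ := by
  unfold FunctionSpaces.eFourierSobolevNorm
  refine ENNReal.rpow_lt_top_of_nonneg (by norm_num) (ne_of_lt ?_)
  set c : ℝ := (1 + ε₀) ^ n with hc
  have hcpos : 0 < c := zpow_pos hε n
  set R : ℝ := c * (1 + ε₀ / 2) with hR
  -- a bound for `ψ̂_i`
  set M : ℝ := SchwartzMap.seminorm ℝ 0 0 (𝓕 (schwartzC (𝒟.ψ i))) with hM
  have hMb : ∀ η, ‖𝓕 (FunctionSpaces.EuclideanSpace.complexify ∘ ⇑(𝒟.ψ i)) η‖ ≤ M := fun η => by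
    rw [← coe_schwartzC, ← SchwartzMap.fourier_coe]
    exact SchwartzMap.norm_le_seminorm ℝ _ η
  set K : ℝ := c ^ ((3 : ℝ) / 2) * |(c ^ 3)⁻¹| with hK
  set C : ℝ≥0∞ := ENNReal.ofReal ((1 + R ^ 2) ^ s) * ENNReal.ofReal ((K * M) ^ 2) with hC
  have hbound : ∀ᵐ ξ ∂(volume : Measure (EuclideanSpace ℝ (Fin 3))),
      ENNReal.ofReal ((1 + ‖ξ‖ ^ 2) ^ s) * ‖fourierFn (cascadeWavelet ε₀ (𝒟.ψ i) n) ξ‖ₑ ^ 2 ≤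
        (closedBall (0 : (EuclideanSpace ℝ (Fin 3))) R).indicator (fun _ => C) ξ := by
    filter_upwards [𝒟.fourierFn_cascadeWavelet_eq_zero hε i n,
      fourierFn_cascadeWavelet hε (𝒟.ψ i) n] with ξ h0 hξ
    by_cases hin : ξ ∈ freqRegion 𝒟 i n
    · have hnorm : ‖ξ‖ ≤ R := (𝒟.norm_of_mem_freqRegion hε i n hin).2
      rw [Set.indicator_of_mem (by simpa [mem_closedBall] using hnorm), hC]
      refine mul_le_mul' (ENNReal.ofReal_le_ofReal (Real.rpow_le_rpow (by positivity)
        (by nlinarith [norm_nonneg ξ]) hs)) ?_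
      have hv : ‖fourierFn (cascadeWavelet ε₀ (𝒟.ψ i) n) ξ‖ ≤ K * M := by
        rw [hξ, norm_smul, norm_smul, Complex.norm_real, Real.norm_of_nonneg (by positivity),
          Real.norm_of_nonneg (abs_nonneg _), hK, mul_assoc]
        gcongr
        exact hMb _
      rw [← ofReal_norm, ← ENNReal.ofReal_pow (norm_nonneg _)]
      exact ENNReal.ofReal_le_ofReal (pow_le_pow_left₀ (norm_nonneg _) hv 2)
    · rw [h0 hin]
      simp
  calc ∫⁻ ξ, ENNReal.ofReal ((1 + ‖ξ‖ ^ 2) ^ s) *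
        ‖fourierFn (cascadeWavelet ε₀ (𝒟.ψ i) n) ξ‖ₑ ^ 2 ∂(volume : Measure (EuclideanSpace ℝ (Fin 3)))
      ≤ ∫⁻ ξ, (closedBall (0 : (EuclideanSpace ℝ (Fin 3))) R).indicator (fun _ => C) ξ ∂(volume : Measure (EuclideanSpace ℝ (Fin 3))) :=
        lintegral_mono_ae hbound
    _ = C * volume (closedBall (0 : (EuclideanSpace ℝ (Fin 3))) R) := lintegral_indicator_const measurableSet_closedBall C
    _ < ∞ := ENNReal.mul_lt_top (ENNReal.mul_lt_top ENNReal.ofReal_lt_top ENNReal.ofReal_lt_top)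
        measure_closedBall_lt_top

/-- **The wavelets belong to `H¹⁰_df(ℝ³)`** (finite `H¹⁰` norm, real, divergence free), so they are
admissible test fields in the mild formulation (1.15)/(3.3) and the datum `ψ_{1,n₀}` (4.4) lies in
`H¹⁰_df` (Tao, p. 21: "`ψ_i ∈ H¹⁰_df(ℝ³)`"). [cite: Tao2016AveragedNS, §4 p. 21] -/
theorem memH10df_cascadeWavelet (hε : 0 < 1 + ε₀) (i : Fin m) (n : ℤ) :
    MemH10df (cascadeWavelet ε₀ (𝒟.ψ i) n) :=
  ⟨𝒟.eFourierSobolevNorm_cascadeWavelet_lt_top hε 10 (by norm_num) i n,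
    isReal_cascadeWavelet ε₀ (𝒟.ψ i) n, 𝒟.isFourierDivFree_cascadeWavelet hε i n⟩

/-- The `L²` mass of `ψ̂_{i,n}` is one: `(∫ |ψ̂_{i,n}|²)^{1/2} = ‖ψ_{i,n}‖ = 1` (Plancherel). [cite: Tao2016AveragedNS, §4 p. 21] -/
theorem lintegral_fourierFn_cascadeWavelet (hε : 0 < 1 + ε₀) (i : Fin m) (n : ℤ) :
    (∫⁻ ξ, ‖fourierFn (cascadeWavelet ε₀ (𝒟.ψ i) n) ξ‖ₑ ^ (2 : ℝ) ∂(volume : Measure (EuclideanSpace ℝ (Fin 3)))) ^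
        (1 / (2 : ℝ)) = 1 := by
  have h := eLpNorm_eq_lintegral_rpow_enorm_toReal (p := (2 : ℝ≥0∞)) (μ := (volume : Measure (EuclideanSpace ℝ (Fin 3))))
    (f := fourierFn (cascadeWavelet ε₀ (𝒟.ψ i) n)) two_ne_zero ENNReal.ofNat_ne_top
  simp only [ENNReal.toReal_ofNat] at h
  rw [← h, fourierFn, ← Lp.enorm_def, ← ofReal_norm, MeasureTheory.Lp.norm_fourier_eq,
    𝒟.norm_cascadeWavelet hε, ENNReal.ofReal_one]

/-- **Decay of the wavelet coefficients of an `H¹⁰` field** (Tao, p. 14: "from the Plancherel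
theorem … `∑ₙ (1 + (1+ε₀)^{2n})^{10} |⟨u, ψ_{1,n}⟩|² < ∞`", and p. 22, (4.6)): since `ψ̂_{i,n}` lives
where `|ξ| > (1+ε₀)ⁿ` and has unit `L²` mass,
`|⟨u, ψ_{i,n}⟩| ≤ (1 + (1+ε₀)^{2n})^{-5} ‖u‖_{H¹⁰}` (Cauchy–Schwarz on the Fourier side). Stated in
`ℝ≥0∞` (no finiteness hypothesis). [cite: Tao2016AveragedNS, §4 (4.6)] -/
theorem enorm_pairing_cascadeWavelet_le (hε : 0 < 1 + ε₀) (i : Fin m) (n : ℤ) (u : L2C) :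
    ‖pairing u (cascadeWavelet ε₀ (𝒟.ψ i) n)‖ₑ ≤
      ENNReal.ofReal ((1 + ((1 + ε₀) ^ n) ^ 2) ^ (-(5 : ℝ))) *
        FunctionSpaces.eFourierSobolevNorm 10 u := by
  set ψn := cascadeWavelet ε₀ (𝒟.ψ i) n with hψn
  set c : ℝ := (1 + ε₀) ^ n with hc
  have hcpos : 0 < c := zpow_pos hε n
  set K₀ : ℝ≥0∞ := ENNReal.ofReal ((1 + c ^ 2) ^ (-(5 : ℝ))) with hK₀
  set W : EuclideanSpace ℝ (Fin 3) → ℝ≥0∞ := fun ξ => ENNReal.ofReal ((1 + ‖ξ‖ ^ 2) ^ (5 : ℝ))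
    with hW
  have hWmeas : Measurable W := by
    rw [hW]
    fun_prop
  have hFmeas : ∀ v : L2C, AEMeasurable (fun ξ => ‖fourierFn v ξ‖ₑ) volume := fun v =>
    (Lp.aestronglyMeasurable _).aemeasurable.enorm
  rw [pairing_eq_integral_fourierFn (isReal_cascadeWavelet ε₀ (𝒟.ψ i) n)]
  -- pointwise: on the support `1 ≤ K₀ W`, off it `ψ̂ₙ = 0`
  have hpt : ∀ᵐ ξ ∂(volume : Measure (EuclideanSpace ℝ (Fin 3))),
      ‖inner ℂ (fourierFn ψn ξ) (fourierFn u ξ)‖ₑ ≤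
        ‖fourierFn ψn ξ‖ₑ * (K₀ * (W ξ * ‖fourierFn u ξ‖ₑ)) := by
    filter_upwards [𝒟.fourierFn_cascadeWavelet_eq_zero hε i n] with ξ h0
    by_cases hin : ξ ∈ freqRegion 𝒟 i n
    · have hξ : c < ‖ξ‖ := (𝒟.norm_of_mem_freqRegion hε i n hin).1
      have h1 : (1 : ℝ≥0∞) ≤ K₀ * W ξ := by
        rw [hK₀, hW, ← ENNReal.ofReal_mul (by positivity), ← ENNReal.ofReal_one]
        refine ENNReal.ofReal_le_ofReal ?_
        rw [Real.rpow_neg (by positivity), inv_mul_eq_div, le_div_iff₀ (by positivity), one_mul]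
        exact Real.rpow_le_rpow (by positivity) (by nlinarith [norm_nonneg ξ]) (by norm_num)
      calc ‖inner ℂ (fourierFn ψn ξ) (fourierFn u ξ)‖ₑ
          ≤ ‖fourierFn ψn ξ‖ₑ * ‖fourierFn u ξ‖ₑ := by
            rw [← ofReal_norm, ← ofReal_norm, ← ofReal_norm, ← ENNReal.ofReal_mul (norm_nonneg _)]
            exact ENNReal.ofReal_le_ofReal (norm_inner_le_norm _ _)
        _ = ‖fourierFn ψn ξ‖ₑ * (1 * (1 * ‖fourierFn u ξ‖ₑ)) := by rw [one_mul, one_mul]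
        _ ≤ ‖fourierFn ψn ξ‖ₑ * (K₀ * W ξ * (1 * ‖fourierFn u ξ‖ₑ)) := by gcongr
        _ = ‖fourierFn ψn ξ‖ₑ * (K₀ * (W ξ * ‖fourierFn u ξ‖ₑ)) := by rw [one_mul, mul_assoc]
    · rw [hψn, h0 hin, inner_zero_left, enorm_zero]
      exact zero_le
  calc ‖∫ ξ, inner ℂ (fourierFn ψn ξ) (fourierFn u ξ)‖ₑ
      ≤ ∫⁻ ξ, ‖inner ℂ (fourierFn ψn ξ) (fourierFn u ξ)‖ₑ := enorm_integral_le_lintegral_enorm _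
    _ ≤ ∫⁻ ξ, ‖fourierFn ψn ξ‖ₑ * (K₀ * (W ξ * ‖fourierFn u ξ‖ₑ)) := lintegral_mono_ae hpt
    _ = K₀ * ∫⁻ ξ, ((fun ξ => ‖fourierFn ψn ξ‖ₑ) * fun ξ => W ξ * ‖fourierFn u ξ‖ₑ) ξ := by
        rw [← lintegral_const_mul' _ _ ENNReal.ofReal_ne_top]
        exact lintegral_congr fun ξ => by simp only [Pi.mul_apply]; ring
    _ ≤ K₀ * ((∫⁻ ξ, ‖fourierFn ψn ξ‖ₑ ^ (2 : ℝ)) ^ (1 / (2 : ℝ)) *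
          (∫⁻ ξ, (W ξ * ‖fourierFn u ξ‖ₑ) ^ (2 : ℝ)) ^ (1 / (2 : ℝ))) := by
        gcongr
        exact ENNReal.lintegral_mul_le_Lp_mul_Lq volume Real.HolderConjugate.two_two (hFmeas ψn)
          (hWmeas.aemeasurable.mul (hFmeas u))
    _ = K₀ * FunctionSpaces.eFourierSobolevNorm 10 u := by
        rw [𝒟.lintegral_fourierFn_cascadeWavelet hε i n, one_mul]
        unfold FunctionSpaces.eFourierSobolevNorm
        congr 2
        refine lintegral_congr fun ξ => ?_
        rw [ENNReal.mul_rpow_of_nonneg _ _ (by norm_num), ENNReal.rpow_two, ENNReal.rpow_two, hW]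
        simp only
        rw [← ENNReal.ofReal_pow (by positivity), ← Real.rpow_natCast,
          ← Real.rpow_mul (by positivity)]
        norm_num
        rfl

end CascadeWaveletData

end WaveletFourier

end Literature.Analysis.FluidPDE.Tao2016
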